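import Literature.Geometry.Manifold.DeRhamFundamentalClassPairing
import Literature.Geometry.Symplectic.SymplecticOrientation
import HarnessLib

/-!
# A symplectic surface in a symplectic `4`-manifold represents a non-torsion homology class

McDuff–Salamon (2017), Ex. 4.4.5 and the proof of Thm. 13.3.11 ("`∫_Σ ω > 0`, hence `Σ`
represents a non-torsion homology class"); this is the first half of conjunct (iii) of the named
fact `Literature.Geometry.Symplectic.canonicalClass_sq_and_adjunction_of_symplectic_four`
(`CanonicalClassSqAndAdjunctionOfSymplecticFour.lean`), in its exact typing and for EVERY
homological `ℤ`-orientation `μS` of the surface.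

For a smooth closed `2`-form `s` on a smooth `4`-manifold `N` (charted on `ℝ⁴`), a compact connected
surface `S` (charted on `ℝ²`) and a smooth embedding — indeed any `C^∞` map — `b : S → N` along
which `s` is non-degenerate on `S`, the area form `b^* s` vanishes nowhere, so it is not exact
(Stokes) and its de Rham class pairs non-trivially with `[S] ⊗ 1`; by naturality of de Rham's
integration isomorphism, `⟨e_N [s], b_* ([S] ⊗ 1)⟩ ≠ 0`, whence `b_* [S] ∈ H₂(N; ℤ)` is not torsion
(`Literature.Geometry.Manifold.map_fundamentalClass_not_mem_torsion`):

* `symplecticSurface_pullback_ne_zero` — `(b^* s)_y ≠ 0` at every point;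
* `map_fundamentalClass_not_mem_torsion_of_symplecticSurface` — `b_* [S]_{μS} ∉ T(H₂(N; ℤ))` for a
  `C^∞` map `b` (no compactness of `N` needed beyond σ-compactness);
* `map_fundamentalClass_not_mem_torsion_of_isSmoothEmbedding` — the same with the binders of the
  named fact (closed `N`, `Manifold.IsSmoothEmbedding b`, `S` not assumed Hausdorff: it is, as a
  subspace of `N`).

Everything is proved; no definitions, no named facts.

## References

* D. McDuff, D. Salamon, *Introduction to Symplectic Topology*, 3rd ed., OUP (2017), §2.1
  Cor. 2.1.4, Ex. 4.4.5, proof of Thm. 13.3.11. [McDuffSalamon2017]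
* J. M. Lee, *Introduction to Smooth Manifolds*, 2nd ed. (2013), Thm. 17.31, Thm. 18.14.
  [LeeSmoothManifolds2013]
-/

noncomputable section

open scoped Manifold ContDiff Topology
open Set Function
open Literature.AlgebraicTopology.SingularHomology Literature.Geometry.Kaehler
  Literature.Geometry.Manifold Literature.NumberTheory.Transcendental

namespace Literature.Geometry.Symplectic

variable {N : Type} [TopologicalSpace N] [T2Space N] [ChartedSpace (EuclideanSpace ℝ (Fin 4)) N]
  {S : Type} [TopologicalSpace S] [ChartedSpace (EuclideanSpace ℝ (Fin 2)) S]

omit [T2Space N] in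
/-- **The area form of a symplectic surface vanishes nowhere**: if `s` is non-degenerate along
`b : S → N` on `S` (for every `v ≠ 0` in `T_y S` some `w` has `s (db v, db w) ≠ 0`), then
`(b^* s)_y ≠ 0` for all `y` (McDuff–Salamon (2017), §2.1 Cor. 2.1.4: a symplectic form is an
area form on a symplectic `2`-plane). [cite: McDuffSalamon2017, §2.1 Cor. 2.1.4] -/
theorem symplecticSurface_pullback_ne_zero (s : MForm (𝓡 4) N ℝ 2) (b : S → N)
    (hnd : ∀ y (v : TangentSpace (𝓡 2) y), v ≠ 0 → ∃ w : TangentSpace (𝓡 2) y,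
      s (b y) ![mfderiv (𝓡 2) (𝓡 4) b y v, mfderiv (𝓡 2) (𝓡 4) b y w] ≠ 0) (y : S) :
    s.pullback (𝓡 2) b y ≠ 0 := fun h0 ↦ by
  have hv : ((EuclideanSpace.basisFun (Fin 2) ℝ).toBasis 0 : EuclideanSpace ℝ (Fin 2)) ≠ 0 :=
    Module.Basis.ne_zero _ 0
  obtain ⟨w, hw⟩ := hnd y ((EuclideanSpace.basisFun (Fin 2) ℝ).toBasis 0) hv
  apply hw
  rw [← pullback_apply_vecTwo, h0]
  rfl

/-- **A symplectic surface represents a non-torsion class** (McDuff–Salamon (2017), Ex. 4.4.5 /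
proof of Thm. 13.3.11: "`∫_Σ ω > 0`", so `[Σ]` is not torsion): for a smooth closed `2`-form `s` on
a Hausdorff σ-compact smooth `4`-manifold `N`, a closed connected Hausdorff surface `S` with any
`ℤ`-orientation `μS`, and a `C^∞` map `b : S → N` along which `s` is non-degenerate on `S`, the
class `b_* [S] ∈ H₂(N; ℤ)` is not a torsion element. (Proof: the nowhere-vanishing area form
`b^* s` is not exact by Stokes, so `⟨e_N [s], b_* ([S] ⊗ 1)⟩ = ⟨e_S [b^* s], [S] ⊗ 1⟩ ≠ 0` by
de Rham's theorem, `Literature.Geometry.Manifold.map_fundamentalClass_not_mem_torsion`.)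
[cite: McDuffSalamon2017, Ex. 4.4.5; proof of Thm. 13.3.11] -/
theorem map_fundamentalClass_not_mem_torsion_of_symplecticSurface [SigmaCompactSpace N]
    [IsManifold (𝓡 4) ∞ N] [T2Space S] [CompactSpace S] [ConnectedSpace S] [IsManifold (𝓡 2) ∞ S]
    (s : MForm (𝓡 4) N ℝ 2) (hs : IsSmoothForm s) (hcl : IsClosedForm s)
    (b : S → N) (hb : ContMDiff (𝓡 2) (𝓡 4) ∞ b)
    (hnd : ∀ y (v : TangentSpace (𝓡 2) y), v ≠ 0 → ∃ w : TangentSpace (𝓡 2) y,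
      s (b y) ![mfderiv (𝓡 2) (𝓡 4) b y v, mfderiv (𝓡 2) (𝓡 4) b y w] ≠ 0)
    (μS : HomologicalOrientation ℤ S 2) :
    singularHomology.map ℤ ℤ ⟨b, hb.continuous⟩ 2 μS.fundamentalClass ∉
      Submodule.torsion ℤ (singularHomology ℤ ℤ N 2) :=
  map_fundamentalClass_not_mem_torsion (E' := EuclideanSpace ℝ (Fin 4)) μS hb ⟨s, hs, hcl⟩
    (symplecticSurface_pullback_ne_zero s b hnd)

/-- **Conjunct (iii)a of `canonicalClass_sq_and_adjunction_of_symplectic_four`, for every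
orientation of the surface.** With the binders of that named fact — a closed smooth `4`-manifold
`N`, a smooth closed `2`-form `s`, a compact connected surface `S` smoothly embedded by `b` with `s`
non-degenerate on it — and ANY homological `ℤ`-orientation `μS` of `S`, the class
`b_* [S] ∈ H₂(N; ℤ)` is not a torsion element (McDuff–Salamon (2017), Ex. 4.4.5 / proof of
Thm. 13.3.11). `S` is Hausdorff as `b` is an embedding into the Hausdorff `N`.
[cite: McDuffSalamon2017, Ex. 4.4.5; proof of Thm. 13.3.11] -/
theorem map_fundamentalClass_not_mem_torsion_of_isSmoothEmbedding [SecondCountableTopology N]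
    [CompactSpace N] [IsManifold (𝓡 4) ∞ N] [CompactSpace S] [ConnectedSpace S]
    [IsManifold (𝓡 2) ∞ S]
    (s : MForm (𝓡 4) N ℝ 2) (hs : IsSmoothForm s) (hcl : IsClosedForm s) (b : S → N)
    (hb : Manifold.IsSmoothEmbedding (𝓡 2) (𝓡 4) ∞ b)
    (hnd : ∀ y (v : TangentSpace (𝓡 2) y), v ≠ 0 → ∃ w : TangentSpace (𝓡 2) y,
      s (b y) ![mfderiv (𝓡 2) (𝓡 4) b y v, mfderiv (𝓡 2) (𝓡 4) b y w] ≠ 0)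
    (μS : HomologicalOrientation ℤ S 2) :
    singularHomology.map ℤ ℤ ⟨b, hb.isEmbedding.continuous⟩ 2 μS.fundamentalClass ∉
      Submodule.torsion ℤ (singularHomology ℤ ℤ N 2) := by
  haveI : T2Space S := hb.isEmbedding.t2Space
  exact map_fundamentalClass_not_mem_torsion_of_symplecticSurface s hs hcl b hb.contMDiff hnd μS

end Literature.Geometry.Symplectic
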